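import Mathlib
import Summits.ValiantsHypothesis.ValiantsHypothesis.Theorems.KPlusLogSqLawStaticPathCompounding
import Summits.ValiantsHypothesis.ValiantsHypothesis.Theorems.KPlusLogSqLawStaticPathJunction

/-!
# The static tridiagonal sector: GLUING THEOREM and linear compounding at EVERY size

HONEST FRAMING.  Helper file for the witness-plan stub `stub_tridiagonalSectorB` of the crux `WeakLifting`
(`Summit.ValiantsHypothesis.ValiantsHypothesis.Theses.KPlusLogSqLaw.WeakLifting`, item stmt-ValiantsHypothesis-19561, route
`KPlusLogSqLaw`, cell `pub-symmetroid`; seat val-sym-lift-p4 g6, 2026-08-27).  Statements about a SUB-SECTOR (static = every entry of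
`Σ_l X^{d_l} S_l` carried by at most one class) and about real polynomials; nothing here bears on the sector law in its window, on
`WeakLifting`, `TropicalB`, Conjecture B, `MatrixDescartes` (stmt-ValiantsHypothesis-18050), the DoorA registers or VP ≠ VNP.

WHAT IS PROVED.
* `det_pencil_glue`, `det_pencil_rescale`, `det_pencil_const_smul`: block-diagonal gluing multiplies determinants; scaling the
  class-`l` coefficients by `c^(d l)` composes the determinant with `C c * X`; a common constant factor `a` gives `C a ^ m`.
* `glue` (**GLUING THEOREM**, dead-separator concatenation of GAP-LIFT §12.3 (a)): two real symmetric tridiagonal STATIC pencils with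
  the same exponents, diagonals carried by one class `l₀` with coefficients in any prescribed set `P`, and `r₁ > 0`, `r₂ > 0` distinct
  positive determinant zeros, glue to one of size `m₁ + m₂` of the same kind with at least `r₁ + r₂` such zeros (the second block is
  read in `c·x` and renormalised by `c^(−d l₀)`; `c > 0` avoids the finitely many root ratios).  The positive-root count of the sector
  is SUPERADDITIVE in the size.
* ALL-SIZES FAMILIES from the lineage's certified blocks (p488389, p490323, p492713): definite static `6(k+1)`-paths with `≥ 6(k+1)`
  positive zeros (`exists_static_tridiagonal_six_mul_definite`), definite static `12(k+1)`-paths with `≥ 13(k+1)`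
  (`exists_static_tridiagonal_twelve_mul_definite`), free-sign static `8(k+1)`-paths with `≥ 9(k+1)` (`…eight_mul_free`); hence
  CONJECTURE S (`≤ m − 1`) fails at every size `6(k+1)` (`not_staticPathLaw_six_mul`), S_def′ (`≤ m`) at every size `12(k+1)`
  (`not_staticPathLawVertex_twelve_mul`), and no «`m + O(1)`» law exists (`exists_definite_static_excess`): the static path sector
  compounds LINEARLY with constant `≥ 13/12` (definite) resp. `≥ 9/8` (free signs), uniformly in `m`.  Its true growth order (linear?
  the tropical ceiling is the trivial `n(n+1)/2`) stays OPEN (GAP-LIFT §12.9, §13). [folklore: block determinants; data of the lineage]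
-/

set_option linter.dupNamespace false
set_option autoImplicit false

namespace Summit.ValiantsHypothesis.ValiantsHypothesis.Theorems.KPlusLogSqLaw.StaticPathGluing

open Polynomial Finset Matrix

variable {K m m₁ m₂ : ℕ}

/-! ## 1. Block-diagonal gluing of two lacunary pencils with the same exponent vector -/

/-- entries of the pencil `∑ l, X^(d l) • (S l).map C`. -/
theorem pencil_apply (d : Fin K → ℕ) (S : Fin K → Matrix (Fin m) (Fin m) ℝ) (i j : Fin m) :
    (∑ l, ((X : ℝ[X]) ^ d l) • (S l).map C) i j = ∑ l, (X : ℝ[X]) ^ d l * C (S l i j) := by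
  simp [Matrix.sum_apply, Matrix.smul_apply, Matrix.map_apply, smul_eq_mul]

/-- **Determinants multiply under block-diagonal gluing** (same exponents `d`; any re-indexing `e`). [folklore] -/
theorem det_pencil_glue {n : ℕ} (e : Fin m₁ ⊕ Fin m₂ ≃ Fin n) (d : Fin K → ℕ)
    (S₁ : Fin K → Matrix (Fin m₁) (Fin m₁) ℝ) (S₂ : Fin K → Matrix (Fin m₂) (Fin m₂) ℝ) :
    (∑ l, ((X : ℝ[X]) ^ d l) • (Matrix.reindex e e (Matrix.fromBlocks (S₁ l) 0 0 (S₂ l))).map C).det =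
      (∑ l, ((X : ℝ[X]) ^ d l) • (S₁ l).map C).det * (∑ l, ((X : ℝ[X]) ^ d l) • (S₂ l).map C).det := by
  have hM : (∑ l, ((X : ℝ[X]) ^ d l) • (Matrix.reindex e e (Matrix.fromBlocks (S₁ l) 0 0 (S₂ l))).map C) =
      Matrix.reindex e e
        (Matrix.fromBlocks (∑ l, ((X : ℝ[X]) ^ d l) • (S₁ l).map C) 0 0 (∑ l, ((X : ℝ[X]) ^ d l) • (S₂ l).map C)) := by
    refine Matrix.ext fun i j => ?_
    obtain ⟨i', rfl⟩ := e.surjective i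
    obtain ⟨j', rfl⟩ := e.surjective j
    rw [pencil_apply]
    simp only [Matrix.reindex_apply, Matrix.submatrix_apply, Equiv.symm_apply_apply]
    rcases i' with i' | i' <;> rcases j' with j' | j' <;>
      simp [Matrix.fromBlocks_apply₁₁, Matrix.fromBlocks_apply₁₂, Matrix.fromBlocks_apply₂₁, Matrix.fromBlocks_apply₂₂,
        pencil_apply]
  rw [hM, Matrix.det_reindex_self, Matrix.det_fromBlocks_zero₂₁]

/-! ## 2. Rescaling the variable: `x ↦ c·x` -/

/-- Scaling the class-`l` coefficients by `c^(d l)` composes the determinant with `C c * X`. [folklore] -/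
theorem det_pencil_rescale (d : Fin K → ℕ) (S : Fin K → Matrix (Fin m) (Fin m) ℝ) (c : ℝ) :
    (∑ l, ((X : ℝ[X]) ^ d l) • ((c ^ d l) • S l).map C).det =
      ((∑ l, ((X : ℝ[X]) ^ d l) • (S l).map C).det).comp (C c * X) := by
  have hM : (∑ l, ((X : ℝ[X]) ^ d l) • ((c ^ d l) • S l).map C) =
      (Polynomial.compRingHom (C c * X)).mapMatrix (∑ l, ((X : ℝ[X]) ^ d l) • (S l).map C) := by
    refine Matrix.ext fun i j => ?_
    rw [pencil_apply, RingHom.mapMatrix_apply, Matrix.map_apply, pencil_apply, Polynomial.coe_compRingHom_apply,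
      Polynomial.sum_comp]
    refine Finset.sum_congr rfl fun l _ => ?_
    rw [Polynomial.mul_comp, Polynomial.pow_comp, Polynomial.X_comp, Polynomial.C_comp, Matrix.smul_apply,
      smul_eq_mul, mul_pow, ← Polynomial.C_pow, Polynomial.C_mul]
    ring
  rw [hM, ← RingHom.map_det, Polynomial.coe_compRingHom_apply]

/-! ## 3. Root bookkeeping -/

/-- positive-root set of `p.comp (C c * X)` for `c > 0`: the image of that of `p` under `t ↦ t / c`. -/
theorem posRoots_comp_C_mul_X (p : ℝ[X]) (hp : p ≠ 0) {c : ℝ} (hc : 0 < c) :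
    (p.comp (C c * X)).roots.toFinset.filter (fun t => 0 < t) =
      ((p.roots.toFinset.filter (fun t => 0 < t)).image (fun t => t / c)) := by
  have hq : p.comp (C c * X) ≠ 0 := by
    intro h
    rw [Polynomial.comp_eq_zero_iff] at h
    rcases h with h | ⟨_, h⟩
    · exact hp h
    · have := congrArg (fun q => q.coeff 1) h
      simp at this
      exact hc.ne' this
  ext t
  simp only [Finset.mem_filter, Multiset.mem_toFinset, Finset.mem_image, Polynomial.mem_roots hq,
    Polynomial.mem_roots hp, Polynomial.IsRoot.def, Polynomial.eval_comp, Polynomial.eval_mul, Polynomial.eval_C,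
    Polynomial.eval_X]
  constructor
  · rintro ⟨h0, ht⟩
    exact ⟨c * t, ⟨h0, by positivity⟩, by field_simp⟩
  · rintro ⟨s, ⟨hs0, hs⟩, rfl⟩
    refine ⟨?_, by positivity⟩
    rwa [mul_div_cancel₀ _ hc.ne']

/-- positive roots of a product of nonzero polynomials: the union. -/
theorem posRoots_mul (p q : ℝ[X]) (hp : p ≠ 0) (hq : q ≠ 0) :
    (p * q).roots.toFinset.filter (fun t => 0 < t) =
      p.roots.toFinset.filter (fun t => 0 < t) ∪ q.roots.toFinset.filter (fun t => 0 < t) := by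
  ext t
  simp only [Finset.mem_filter, Finset.mem_union, Multiset.mem_toFinset, Polynomial.mem_roots hp,
    Polynomial.mem_roots hq, Polynomial.mem_roots (mul_ne_zero hp hq), Polynomial.IsRoot.def, Polynomial.eval_mul,
    mul_eq_zero]
  tauto

/-- positive roots are unchanged by a nonzero constant factor. -/
theorem posRoots_C_mul (p : ℝ[X]) {a : ℝ} (ha : a ≠ 0) :
    (C a * p).roots.toFinset.filter (fun t => 0 < t) = p.roots.toFinset.filter (fun t => 0 < t) := by
  rw [Polynomial.roots_C_mul _ ha]

/-- A constant factor on all coefficient matrices scales the determinant by `C a ^ m`. [folklore] -/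
theorem det_pencil_const_smul (d : Fin K → ℕ) (S : Fin K → Matrix (Fin m) (Fin m) ℝ) (a : ℝ) :
    (∑ l, ((X : ℝ[X]) ^ d l) • (a • S l).map C).det =
      C a ^ m * (∑ l, ((X : ℝ[X]) ^ d l) • (S l).map C).det := by
  have hM : (∑ l, ((X : ℝ[X]) ^ d l) • (a • S l).map C) = C a • (∑ l, ((X : ℝ[X]) ^ d l) • (S l).map C) := by
    refine Matrix.ext fun i j => ?_
    rw [pencil_apply, Matrix.smul_apply, pencil_apply, smul_eq_mul, Finset.mul_sum]
    refine Finset.sum_congr rfl fun l _ => ?_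
    rw [Matrix.smul_apply, smul_eq_mul, Polynomial.C_mul]
    ring
  rw [hM, Matrix.det_smul, Fintype.card_fin]

/-! ## 4. The gluing theorem: superadditivity of the positive-root count in the size, all structure preserved -/

/-- index values along `Fin m₁ ⊕ Fin m₂ ≃ Fin n` (left summand). -/
theorem val_glueEquiv_inl {n : ℕ} (h : m₁ + m₂ = n) (i : Fin m₁) :
    ((finSumFinEquiv.trans (finCongr h)) (Sum.inl i) : ℕ) = i := by
  simp

/-- index values along `Fin m₁ ⊕ Fin m₂ ≃ Fin n` (right summand). -/
theorem val_glueEquiv_inr {n : ℕ} (h : m₁ + m₂ = n) (i : Fin m₂) :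
    ((finSumFinEquiv.trans (finCongr h)) (Sum.inr i) : ℕ) = m₁ + i := by
  simp

/-- **GLUING THEOREM (dead-separator concatenation).**  Two real symmetric tridiagonal STATIC lacunary pencils with the
same exponent vector `d`, whose diagonals are carried by one class `l₀` with coefficients satisfying an arbitrary predicate `P`,
and with at least `r₁ > 0` resp. `r₂ > 0` distinct positive determinant zeros, glue (block-diagonally, the second block read in the
rescaled variable `c·x` for a suitable `c > 0` and renormalised by the constant `c^(-d l₀)`) to a pencil of size `m₁ + m₂` of the
same kind with at least `r₁ + r₂` distinct positive determinant zeros.  [folklore: block-diagonal determinants multiply; the finitely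
many ratios of roots are avoided by `c`] -/
theorem glue {n : ℕ} (h : m₁ + m₂ = n) (d : Fin K → ℕ) (l₀ : Fin K) (P : ℝ → Prop)
    (S₁ : Fin K → Matrix (Fin m₁) (Fin m₁) ℝ) (S₂ : Fin K → Matrix (Fin m₂) (Fin m₂) ℝ)
    (hS₁ : ∀ l, (S₁ l).IsSymm) (hS₂ : ∀ l, (S₂ l).IsSymm)
    (hT₁ : ∀ l (i j : Fin m₁), (i : ℕ) + 1 < j ∨ (j : ℕ) + 1 < i → S₁ l i j = 0)
    (hT₂ : ∀ l (i j : Fin m₂), (i : ℕ) + 1 < j ∨ (j : ℕ) + 1 < i → S₂ l i j = 0)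
    (hst₁ : ∀ (i j : Fin m₁) (l l' : Fin K), S₁ l i j ≠ 0 → S₁ l' i j ≠ 0 → l = l')
    (hst₂ : ∀ (i j : Fin m₂) (l l' : Fin K), S₂ l i j ≠ 0 → S₂ l' i j ≠ 0 → l = l')
    (hdg₁ : ∀ i : Fin m₁, P (S₁ l₀ i i) ∧ ∀ l, l ≠ l₀ → S₁ l i i = 0)
    (hdg₂ : ∀ i : Fin m₂, P (S₂ l₀ i i) ∧ ∀ l, l ≠ l₀ → S₂ l i i = 0)
    {r₁ r₂ : ℕ} (hr₁ : 0 < r₁) (hr₂ : 0 < r₂)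
    (h₁ : r₁ ≤ ((∑ l, ((X : ℝ[X]) ^ d l) • (S₁ l).map C).det.roots.toFinset.filter (fun t => 0 < t)).card)
    (h₂ : r₂ ≤ ((∑ l, ((X : ℝ[X]) ^ d l) • (S₂ l).map C).det.roots.toFinset.filter (fun t => 0 < t)).card) :
    ∃ S : Fin K → Matrix (Fin n) (Fin n) ℝ, (∀ l, (S l).IsSymm) ∧
      (∀ l (i j : Fin n), (i : ℕ) + 1 < j ∨ (j : ℕ) + 1 < i → S l i j = 0) ∧
      (∀ (i j : Fin n) (l l' : Fin K), S l i j ≠ 0 → S l' i j ≠ 0 → l = l') ∧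
      (∀ i : Fin n, P (S l₀ i i) ∧ ∀ l, l ≠ l₀ → S l i i = 0) ∧
      r₁ + r₂ ≤ ((∑ l, ((X : ℝ[X]) ^ d l) • (S l).map C).det.roots.toFinset.filter (fun t => 0 < t)).card := by
  classical
  -- the two determinants and their positive-root sets
  set p₁ : ℝ[X] := (∑ l, ((X : ℝ[X]) ^ d l) • (S₁ l).map C).det with hp₁
  set p₂ : ℝ[X] := (∑ l, ((X : ℝ[X]) ^ d l) • (S₂ l).map C).det with hp₂
  set R₁ := p₁.roots.toFinset.filter (fun t => 0 < t) with hR₁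
  set R₂ := p₂.roots.toFinset.filter (fun t => 0 < t) with hR₂
  have hp₁0 : p₁ ≠ 0 := by
    intro h0
    have : R₁ = ∅ := by simp [hR₁, h0]
    rw [this, Finset.card_empty] at h₁
    omega
  have hp₂0 : p₂ ≠ 0 := by
    intro h0
    have : R₂ = ∅ := by simp [hR₂, h0]
    rw [this, Finset.card_empty] at h₂
    omega
  -- choose the scale `c > 0` outside the finitely many root ratios
  obtain ⟨c, hc, hcB⟩ := (Set.Ioi_infinite (0 : ℝ)).exists_notMem_finset ((R₁ ×ˢ R₂).image (fun q => q.2 / q.1))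
  rw [Set.mem_Ioi] at hc
  have hcl : ∀ l, 0 < c ^ d l := fun l => pow_pos hc _
  -- the glued family
  let e : Fin m₁ ⊕ Fin m₂ ≃ Fin n := finSumFinEquiv.trans (finCongr h)
  let T₂ : Fin K → Matrix (Fin m₂) (Fin m₂) ℝ := fun l => ((c ^ d l₀)⁻¹ * c ^ d l) • S₂ l
  refine ⟨fun l => Matrix.reindex e e (Matrix.fromBlocks (S₁ l) 0 0 (T₂ l)), ?_, ?_, ?_, ?_, ?_⟩
  · -- symmetry
    intro l
    exact Matrix.IsSymm.reindex
      (Matrix.IsSymm.fromBlocks (hS₁ l) Matrix.transpose_zero (Matrix.IsSymm.smul (hS₂ l) ((c ^ d l₀)⁻¹ * c ^ d l))) e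
  · -- tridiagonal
    intro l i j hij
    obtain ⟨i', rfl⟩ := e.surjective i
    obtain ⟨j', rfl⟩ := e.surjective j
    simp only [Matrix.reindex_apply, Matrix.submatrix_apply, Equiv.symm_apply_apply]
    rcases i' with i' | i' <;> rcases j' with j' | j'
    · rw [Matrix.fromBlocks_apply₁₁]
      rw [val_glueEquiv_inl h, val_glueEquiv_inl h] at hij
      exact hT₁ l i' j' hij
    · rw [Matrix.fromBlocks_apply₁₂]; rfl
    · rw [Matrix.fromBlocks_apply₂₁]; rfl
    · rw [Matrix.fromBlocks_apply₂₂]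
      rw [val_glueEquiv_inr h, val_glueEquiv_inr h] at hij
      have hij' : (i' : ℕ) + 1 < j' ∨ (j' : ℕ) + 1 < i' := by omega
      simp only [T₂, Matrix.smul_apply, smul_eq_mul, hT₂ l i' j' hij', mul_zero]
  · -- static (one class per entry)
    intro i j l l' hl hl'
    obtain ⟨i', rfl⟩ := e.surjective i
    obtain ⟨j', rfl⟩ := e.surjective j
    simp only [Matrix.reindex_apply, Matrix.submatrix_apply, Equiv.symm_apply_apply] at hl hl'
    rcases i' with i' | i' <;> rcases j' with j' | j'
    · rw [Matrix.fromBlocks_apply₁₁] at hl hl'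
      exact hst₁ i' j' l l' hl hl'
    · simp at hl
    · simp at hl
    · rw [Matrix.fromBlocks_apply₂₂] at hl hl'
      simp only [T₂, Matrix.smul_apply, smul_eq_mul] at hl hl'
      exact hst₂ i' j' l l' (right_ne_zero_of_mul hl) (right_ne_zero_of_mul hl')
  · -- diagonal carried by class `l₀`, predicate `P` preserved (the renormalisation makes the class-`l₀` factor `1`)
    intro i
    obtain ⟨i', rfl⟩ := e.surjective i
    simp only [Matrix.reindex_apply, Matrix.submatrix_apply, Equiv.symm_apply_apply]
    rcases i' with i' | i'
    · rw [Matrix.fromBlocks_apply₁₁]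
      refine ⟨(hdg₁ i').1, fun l hl => ?_⟩
      rw [Matrix.fromBlocks_apply₁₁]
      exact (hdg₁ i').2 l hl
    · rw [Matrix.fromBlocks_apply₂₂]
      refine ⟨?_, fun l hl => ?_⟩
      · simp only [T₂, Matrix.smul_apply, smul_eq_mul, inv_mul_cancel₀ (hcl l₀).ne', one_mul]
        exact (hdg₂ i').1
      · rw [Matrix.fromBlocks_apply₂₂]
        simp only [T₂, Matrix.smul_apply, smul_eq_mul, (hdg₂ i').2 l hl, mul_zero]
  · -- root count
    have hT₂eq : ∀ l, T₂ l = (c ^ d l₀)⁻¹ • ((c ^ d l) • S₂ l) := fun l => by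
      simp only [T₂, mul_smul]
    have hdet : (∑ l, ((X : ℝ[X]) ^ d l) • (Matrix.reindex e e (Matrix.fromBlocks (S₁ l) 0 0 (T₂ l))).map C).det =
        p₁ * (C ((c ^ d l₀)⁻¹) ^ m₂ * p₂.comp (C c * X)) := by
      rw [det_pencil_glue e d S₁ T₂]
      simp only [hT₂eq]
      rw [det_pencil_const_smul d (fun l => (c ^ d l) • S₂ l), det_pencil_rescale d S₂ c]
    have ha : C ((c ^ d l₀)⁻¹) ^ m₂ ≠ (0 : ℝ[X]) := by
      rw [← Polynomial.C_pow]
      exact Polynomial.C_ne_zero.mpr (pow_ne_zero _ (inv_ne_zero (hcl l₀).ne'))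
    have hq0 : p₂.comp (C c * X) ≠ 0 := by
      intro h0
      rw [Polynomial.comp_eq_zero_iff] at h0
      rcases h0 with h0 | ⟨_, h0⟩
      · exact hp₂0 h0
      · have := congrArg (fun q => q.coeff 1) h0
        simp at this
        exact hc.ne' this
    have hR : ((∑ l, ((X : ℝ[X]) ^ d l) • (Matrix.reindex e e (Matrix.fromBlocks (S₁ l) 0 0 (T₂ l))).map C).det.roots.toFinset.filter
          (fun t => 0 < t)) = R₁ ∪ R₂.image (fun t => t / c) := by
      rw [hdet, posRoots_mul _ _ hp₁0 (mul_ne_zero ha hq0), ← Polynomial.C_pow, posRoots_C_mul _ (pow_ne_zero _ (inv_ne_zero (hcl l₀).ne')),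
        posRoots_comp_C_mul_X _ hp₂0 hc]
    have hdisj : Disjoint R₁ (R₂.image (fun t => t / c)) := by
      rw [Finset.disjoint_left]
      intro t ht ht'
      rw [Finset.mem_image] at ht'
      obtain ⟨s, hs, rfl⟩ := ht'
      have hs0 : 0 < s := (Finset.mem_filter.mp hs).2
      apply hcB
      rw [Finset.mem_image]
      refine ⟨(s / c, s), Finset.mem_product.mpr ⟨ht, hs⟩, ?_⟩
      field_simp
    have hinj : Function.Injective (fun t : ℝ => t / c) := fun a b hab => by
      simpa [div_left_inj' hc.ne'] using hab
    rw [hR, Finset.card_union_of_disjoint hdisj, Finset.card_image_of_injective _ hinj]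
    omega

/-! ## 5. All-sizes families: the static path sector compounds LINEARLY, uniformly in the size -/

open Summit.ValiantsHypothesis.ValiantsHypothesis.Theorems.KPlusLogSqLaw.StaticPath in
/-- **DEFINITE static symmetric tridiagonal pencils of every size `m = 6(k+1)` with at least `m` distinct positive determinant
zeros** (`K = 5`, diagonal carried by class `2` with coefficient `+1`): `k+1` glued copies of the lineage's certified `6 × 6` block
`StaticPath.exists_static_tridiagonal_six_definite` (p488389).  Hence CONJECTURE S («a static tree pencil has at most `#edges = m − 1`
positive zeros», GAP-LIFT §11) fails at EVERY size `6(k+1)`, not only at `m = 6`. [gluing theorem of this file] -/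
theorem exists_static_tridiagonal_six_mul_definite (k : ℕ) :
    ∃ (d : Fin 5 → ℕ) (S : Fin 5 → Matrix (Fin (6 * (k + 1))) (Fin (6 * (k + 1))) ℝ), (∀ l, (S l).IsSymm) ∧
      (∀ l (i j : Fin (6 * (k + 1))), (i : ℕ) + 1 < j ∨ (j : ℕ) + 1 < i → S l i j = 0) ∧
      (∀ (i j : Fin (6 * (k + 1))) (l l' : Fin 5), S l i j ≠ 0 → S l' i j ≠ 0 → l = l') ∧
      (∀ i : Fin (6 * (k + 1)), S 2 i i = 1 ∧ ∀ l, l ≠ 2 → S l i i = 0) ∧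
      6 * (k + 1) ≤ ((∑ l, (X : ℝ[X]) ^ d l • (S l).map C).det.roots.toFinset.filter (fun t => 0 < t)).card := by
  obtain ⟨d, S, hS, hT, hst, hdg, h6⟩ := exists_static_tridiagonal_six_definite
  refine ⟨d, ?_⟩
  induction k with
  | zero => exact ⟨S, hS, hT, hst, hdg, h6⟩
  | succ k ih =>
    obtain ⟨S', hS', hT', hst', hdg', hk⟩ := ih
    have e1 : 6 * (k + 1) + 6 = 6 * (k + 1 + 1) := by ring
    obtain ⟨S'', h1, h2, h3, h4, h5⟩ := glue e1 d 2 (fun a => a = 1) S' S hS' hS hT' hT hst' hst hdg' hdg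
      (by omega) (by norm_num) hk h6
    exact ⟨S'', h1, h2, h3, h4, by omega⟩

open Summit.ValiantsHypothesis.ValiantsHypothesis.Theorems.KPlusLogSqLaw.StaticPath in
/-- **DEFINITE static symmetric tridiagonal pencils of every size `m = 12(k+1)` with at least `13(k+1) = 13m/12 > m` distinct
positive determinant zeros** (`K = 6`, diagonal carried by class `3` with coefficient `+1`): glued copies of the lineage's certified
junction block `StaticPath.exists_static_tridiagonal_twelve_thirteen` (p492713).  Hence the repaired law S_def′ («definite static path
pencils of size `m` have at most `m` positive zeros», GAP-LIFT §12.4) fails at EVERY size `12(k+1)`: in the definite static slice the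
positive-root count grows at least like `13m/12` — LINEAR COMPOUNDING WITH A CONSTANT `> 1`, uniformly in `m`. [gluing theorem] -/
theorem exists_static_tridiagonal_twelve_mul_definite (k : ℕ) :
    ∃ (d : Fin 6 → ℕ) (S : Fin 6 → Matrix (Fin (12 * (k + 1))) (Fin (12 * (k + 1))) ℝ), (∀ l, (S l).IsSymm) ∧
      (∀ l (i j : Fin (12 * (k + 1))), (i : ℕ) + 1 < j ∨ (j : ℕ) + 1 < i → S l i j = 0) ∧
      (∀ (i j : Fin (12 * (k + 1))) (l l' : Fin 6), S l i j ≠ 0 → S l' i j ≠ 0 → l = l') ∧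
      (∀ i : Fin (12 * (k + 1)), S 3 i i = 1 ∧ ∀ l, l ≠ 3 → S l i i = 0) ∧
      13 * (k + 1) ≤ ((∑ l, (X : ℝ[X]) ^ d l • (S l).map C).det.roots.toFinset.filter (fun t => 0 < t)).card := by
  obtain ⟨d, S, hS, hT, hst, hdg, h13⟩ := exists_static_tridiagonal_twelve_thirteen
  refine ⟨d, ?_⟩
  induction k with
  | zero => exact ⟨S, hS, hT, hst, hdg, h13⟩
  | succ k ih =>
    obtain ⟨S', hS', hT', hst', hdg', hk⟩ := ih
    have e1 : 12 * (k + 1) + 12 = 12 * (k + 1 + 1) := by ring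
    obtain ⟨S'', h1, h2, h3, h4, h5⟩ := glue e1 d 3 (fun a => a = 1) S' S hS' hS hT' hT hst' hst hdg' hdg
      (by omega) (by norm_num) hk h13
    exact ⟨S'', h1, h2, h3, h4, by omega⟩

open Summit.ValiantsHypothesis.ValiantsHypothesis.Theorems.KPlusLogSqLaw.StaticPath in
/-- **FREE-SIGN static symmetric tridiagonal pencils of every size `m = 8(k+1)` with at least `9(k+1) = 9m/8` distinct positive
determinant zeros** (`K = 6`, diagonal carried by class `1` with coefficients `±1`): glued copies of
`StaticPath.exists_static_tridiagonal_eight_nine` (p490323). [gluing theorem] -/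
theorem exists_static_tridiagonal_eight_mul_free (k : ℕ) :
    ∃ (d : Fin 6 → ℕ) (S : Fin 6 → Matrix (Fin (8 * (k + 1))) (Fin (8 * (k + 1))) ℝ), (∀ l, (S l).IsSymm) ∧
      (∀ l (i j : Fin (8 * (k + 1))), (i : ℕ) + 1 < j ∨ (j : ℕ) + 1 < i → S l i j = 0) ∧
      (∀ (i j : Fin (8 * (k + 1))) (l l' : Fin 6), S l i j ≠ 0 → S l' i j ≠ 0 → l = l') ∧
      (∀ i : Fin (8 * (k + 1)), (S 1 i i = 1 ∨ S 1 i i = -1) ∧ ∀ l, l ≠ 1 → S l i i = 0) ∧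
      9 * (k + 1) ≤ ((∑ l, (X : ℝ[X]) ^ d l • (S l).map C).det.roots.toFinset.filter (fun t => 0 < t)).card := by
  obtain ⟨d, S, hS, hT, hst, hdg, h9⟩ := exists_static_tridiagonal_eight_nine
  refine ⟨d, ?_⟩
  induction k with
  | zero => exact ⟨S, hS, hT, hst, hdg, h9⟩
  | succ k ih =>
    obtain ⟨S', hS', hT', hst', hdg', hk⟩ := ih
    have e1 : 8 * (k + 1) + 8 = 8 * (k + 1 + 1) := by ring
    obtain ⟨S'', h1, h2, h3, h4, h5⟩ := glue e1 d 1 (fun a => a = 1 ∨ a = -1) S' S hS' hS hT' hT hst' hst hdg' hdg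
      (by omega) (by norm_num) hk h9
    exact ⟨S'', h1, h2, h3, h4, by omega⟩

/-! ## 6. Corollaries: the lineage's static laws fail at every size of the families -/

/-- **CONJECTURE S fails at every size `6(k+1)`**: it is false that every real symmetric tridiagonal STATIC `6(k+1) × 6(k+1)`
lacunary pencil with diagonal carried by one class with coefficient `+1` has at most `#edges = 6(k+1) − 1` distinct positive
determinant zeros. [corollary] -/
theorem not_staticPathLaw_six_mul (k : ℕ) :
    ¬ (∀ (K : ℕ) (d : Fin K → ℕ) (S : Fin K → Matrix (Fin (6 * (k + 1))) (Fin (6 * (k + 1))) ℝ), (∀ l, (S l).IsSymm) →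
        (∀ l (i j : Fin (6 * (k + 1))), (i : ℕ) + 1 < j ∨ (j : ℕ) + 1 < i → S l i j = 0) →
        (∀ (i j : Fin (6 * (k + 1))) (l l' : Fin K), S l i j ≠ 0 → S l' i j ≠ 0 → l = l') →
        (∃ l₀, ∀ i : Fin (6 * (k + 1)), S l₀ i i = 1 ∧ ∀ l, l ≠ l₀ → S l i i = 0) →
        ((∑ l, (X : ℝ[X]) ^ d l • (S l).map C).det.roots.toFinset.filter (fun t => 0 < t)).card ≤ 6 * (k + 1) - 1) := by
  intro h
  obtain ⟨d, S, hS, hT, hst, hdg, h6⟩ := exists_static_tridiagonal_six_mul_definite k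
  have := h 5 d S hS hT hst ⟨2, hdg⟩
  omega

/-- **S_def′ fails at every size `12(k+1)`**: it is false that every real symmetric tridiagonal STATIC DEFINITE-DIAGONAL
`12(k+1) × 12(k+1)` lacunary pencil has at most `m = 12(k+1)` distinct positive determinant zeros; the excess is at least `k + 1 = m/12`.
[corollary] -/
theorem not_staticPathLawVertex_twelve_mul (k : ℕ) :
    ¬ (∀ (K : ℕ) (d : Fin K → ℕ) (S : Fin K → Matrix (Fin (12 * (k + 1))) (Fin (12 * (k + 1))) ℝ), (∀ l, (S l).IsSymm) →
        (∀ l (i j : Fin (12 * (k + 1))), (i : ℕ) + 1 < j ∨ (j : ℕ) + 1 < i → S l i j = 0) →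
        (∀ (i j : Fin (12 * (k + 1))) (l l' : Fin K), S l i j ≠ 0 → S l' i j ≠ 0 → l = l') →
        (∃ l₀, ∀ i : Fin (12 * (k + 1)), S l₀ i i = 1 ∧ ∀ l, l ≠ l₀ → S l i i = 0) →
        ((∑ l, (X : ℝ[X]) ^ d l • (S l).map C).det.roots.toFinset.filter (fun t => 0 < t)).card ≤ 12 * (k + 1)) := by
  intro h
  obtain ⟨d, S, hS, hT, hst, hdg, h13⟩ := exists_static_tridiagonal_twelve_mul_definite k
  have := h 6 d S hS hT hst ⟨3, hdg⟩
  omega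

/-- **No sub-linear law in the definite static slice**: for every `c < 13/12`-type bound — concretely, for every `k` there is a
definite static symmetric tridiagonal pencil of size `m = 12(k+1)` with MORE THAN `m + k` distinct positive determinant zeros; so
no law of the form «at most `m + O(1)`» holds for definite static path pencils. [corollary] -/
theorem exists_definite_static_excess (k : ℕ) :
    ∃ (m K : ℕ) (d : Fin K → ℕ) (S : Fin K → Matrix (Fin m) (Fin m) ℝ), m = 12 * (k + 1) ∧ (∀ l, (S l).IsSymm) ∧
      (∀ l (i j : Fin m), (i : ℕ) + 1 < j ∨ (j : ℕ) + 1 < i → S l i j = 0) ∧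
      (∀ (i j : Fin m) (l l' : Fin K), S l i j ≠ 0 → S l' i j ≠ 0 → l = l') ∧
      (∃ l₀, ∀ i : Fin m, S l₀ i i = 1 ∧ ∀ l, l ≠ l₀ → S l i i = 0) ∧
      m + k < ((∑ l, (X : ℝ[X]) ^ d l • (S l).map C).det.roots.toFinset.filter (fun t => 0 < t)).card := by
  obtain ⟨d, S, hS, hT, hst, hdg, h13⟩ := exists_static_tridiagonal_twelve_mul_definite k
  exact ⟨12 * (k + 1), 6, d, S, rfl, hS, hT, hst, ⟨3, hdg⟩, by omega⟩

end Summit.ValiantsHypothesis.ValiantsHypothesis.Theorems.KPlusLogSqLaw.StaticPathGluing
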